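import Summits.NavierStokesRegularity.NavierStokesRegularity.Theses.TypeICertificateLadder
import Summits.NavierStokesRegularity.NavierStokesRegularity.Theses.ThreadingFlux
import Summits.NavierStokesRegularity.NavierStokesRegularity.Theorems.TypeICertificateLadderTargetRateClassLiouville
import Summits.NavierStokesRegularity.NavierStokesRegularity.Theorems.TypeICertificateLadderTargetTwistedHeadIdentity
import Summits.NavierStokesRegularity.NavierStokesRegularity.Theorems.TypeICertificateLadderTargetRotatingConjugateDensity
import Summits.NavierStokesRegularity.NavierStokesRegularity.Theorems.TypeICertificateLadderTargetSolitonLaws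
import Summits.NavierStokesRegularity.NavierStokesRegularity.Theorems.TypeICertificateLadderTargetWeightedGapLemma
import Summits.NavierStokesRegularity.NavierStokesRegularity.Theorems.TypeICertificateLadderTargetSolitonBridge
import Summits.NavierStokesRegularity.NavierStokesRegularity.Theorems.TypeICertificateLadderTargetSolitonBridgeTail
import Literature.Analysis.FluidPDE.PineauVicolRSS
import Literature.Analysis.FluidPDE.PineauVicolRSSHolds
import Literature.Analysis.FluidPDE.PineauVicolBernoulli
import Literature.Analysis.FluidPDE.TypeIAncientMild
import Literature.Analysis.FluidPDE.LocalTypeI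
import Literature.Analysis.FluidPDE.SelfSimilar
import HarnessLib.Audit

/-!
# Skeleton line `killing-twisted-bernoulli-solitons` for crux `Target` (stmt-NavierStokesRegularity-1217)

## LEAD'S RESHAPE (gen-1 lead `prover-line-stmt-NavierStokesRegularity-1217-1`, 2026-08-16)

Two stubs of the planner's seven are RESHAPED, using what the tree gained since the skeleton was filed:

* **A1 is GONE as a stub.** The previous lead of this crux (line `head-flux-channel`) LANDED the Type-I zoom
  to the Oseen-gauge RATE class and the reduction `Theorems.noTypeIBlowup_of_rateClassLiouville`
  (p94280: `(∀ C > 0, every u with IsTypeIAncientMild C u vanishes) → NoTypeIBlowup`). The external half of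
  this line therefore starts from a NON-TRIVIAL element of `IsTypeIAncientMild C` (jointly smooth on
  `t < 0`, divergence free, Oseen-mild between all pairs of negative times, `‖u(t,x)‖ ≤ C/√(−t)`), with no
  named fact (the planner's A1 = stmt-1685 needs the undischarged `AlbrittonBarkerForward` and the
  Albritton–Barker energy class `K(C,M)`; neither is needed any more).
* **A2 is RESTATED from the rate class** (`stub_solitonSelection`): a non-trivial element of
  `IsTypeIAncientMild C` forces a non-trivial Type-I rotated self-similar solution in Pineau–Vicol's class.
  Status unchanged: OPEN, EXTERNAL, crux-strength (the `σ ≠ 0` branch of `SymmetryModuliCount.ForcedSymmetry`,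
  stmt-NavierStokesRegularity-4052, plus the apex decay (1.10)); not attacked by this line.
* **B5 is WEAKENED to a COMPACT window** (`stub_windowLiouville`): `a₀ ≤ |α| ≤ A₀`. Both extreme regimes
  are now TREE THEOREMS — `pineauVicol2026_rss_liouville_holds` (P–V Thm 1.4, discharged 2026-08-16:
  `|α| < α₁(C₀)` or `|α| > α₂(C₀)` ⇒ `U ≡ 0`) — and the composition `rssLiouville_of_parts` consumes them
  first, then the explicit small-`α` branch B2–B4, and calls B5 only in the residual window
  `max(α₁, √ε₀/2) ≤ |α| ≤ α₂`. What remains in B5 is exactly Pineau–Vicol Conj. 1.1 in a compact window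
  of rotation rates (OPEN), with the conjugate density, the LAW and the IDENTITY of B2/B3 as tools.
* B1, B2, B3, B4 are kept VERBATIM (registered signatures unchanged).

Registered stubs after the reshape (6): `stub_solitonSelection` (A2', open external) · `stub_twistedHeadIdentity`
(B1) · `stub_rotatingConjugateDensity` (B2) · `stub_solitonLaws` (B3) · `stub_weightedGapLemma` (B4) ·
`stub_windowLiouville` (B5b, open in the window). `Target_of : ThreadingFlux.Target` and
`NoTypeIBlowup_of : TypeICertificateLadder.NoTypeIBlowup` conclude the crux BY NAME from the six.

## STATUS (continuation lead c3, 2026-08-16T18:30Z): skeleton unchanged (2 open stubs A2', B5b); their DAG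
## position kernel-checked — B5b ⇔ `SymmetryModuliCount.SymmetricLiouville` (stmt-4053), A2' ⇔ rate-class
## Liouville modulo B5b, A2' ⇐ `ForcedSymmetry` (stmt-4052)

Landed by c3 (all `--supports` stmt-1217, `Theorems/TypeICertificateLadderTargetSolitonBridge*.lean`):
`solitonBridge_isTypeIAncientMild` (p116633: a Pineau–Vicol-class RSS solution extends to an element of the
Oseen-gauge rate class `IsTypeIAncientMild C₀` on all `t < 0`, same apex constant, classical on `(−∞,0)`),
`solitonBridge_generator` (p117010: the ansatz field is annihilated by the spiral-scaling generator
`∇v·(x + Ax) + v + 2t∂ₜv − Av`, `A = −2αJ`), `solitonBridge_pvAnsatz_of_generator` (p117371: conversely a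
rate-class element annihilated by that generator IS the ansatz of its `t = −1` slice),
`solitonBridge_axisNormalForm` (p117595: any nonzero skew `A` is conjugated to `−2αJ`, `α ≠ 0`, covariantly).
Assembly files (pending farm rebuild at the time of writing): `TypeICertificateLadderTargetSolitonBridge.lean`
(soliton Liouville in P–V's class, all `α` — hence B5b verbatim — FROM `ExtremalTypeIConstant.SpiralScalingLiouville`
(stmt-8216) / `SymmetricLiouville` (stmt-4053) / `TypeIAncientLiouville` (stmt-4050); A2' FROM rate-class
Liouville (vacuous) and from `ForcedSymmetry` (stmt-4052); A2' ⇔ rate-class Liouville MODULO soliton Liouville —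
the costume check) and `TypeICertificateLadderTargetSolitonBridgeEquivalence.lean` (the converse:
soliton Liouville ⇒ the Type-I core of 4053 ⇒ 4053, by normal form + orbit integration + KNSS pressure + that
route's Oseen bootstrap; hence `SymmetricLiouville ⇔ P–V Conj. 1.1 (their class, all α)` and
**B5b verbatim ⇔ SymmetricLiouville**). Net census: the residual of crux 1217 on this line is EXACTLY route
`SymmetryModuliCount`'s pair (4052 `ForcedSymmetry`, 4053 `SymmetricLiouville`), with 4050 ⇔ 4052 ∧ 4053 there
and crux 1217 ⇐ 4052 alone (p106694). Nothing lemma-sized remains on this line; both stubs are open mathematics.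

## STATUS (lead gen-1, 2026-08-16T14Z, end of cycle 1): B1–B4 LANDED in one wave; two open leaves; Part D

LANDED under `Summits/NavierStokesRegularity/NavierStokesRegularity/Theorems/` (all `--supports` stmt-1217; the
stub declarations below are now DEFINED as the tree theorems): B1 `stub_twistedHeadIdentity` p97091, B2
`stub_rotatingConjugateDensity` p105556 (+ nine tool files Hardy/Weak/Smooth/Kato/Positive/Decay/Bounds/
Gradient/GradBound), B3 `stub_solitonLaws` p101267 (+ `rss_profile_system` p99698), B4 `stub_weightedGapLemma`
p100133 (+ slice file p98519). OPEN: A2' `stub_solitonSelection` (external, crux-strength) and B5b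
`stub_windowLiouville` (Pineau–Vicol Conj. 1.1 in a compact window) — both open MATHEMATICS, not Lean debt;
companion seat a1-0 has landed the B5b squeeze tools (`rotationDefect_liouville`, `torque_identity`,
`torqueEnstrophy_eq`, `axialVorticity_liouville_of_density`, …). NEW Part D: the crux is a corollary of the
existing open crux `ForcedSymmetry` (stmt-4052) by `Theorems.noTypeIBlowup_of_forcedSymmetry`; the seventh
registered stub `stub_forcedSymmetry` is that item by name.

## Planner's description (round 1; A1/A2/B5 paragraphs superseded by the reshape above)

Crux `Target` = `ThreadingFlux.Target` ≡ `TypeICertificateLadder.NoTypeIBlowup` ≡ `CoreLogGas.NoTypeIBlowup`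
(syntactically identical decls; Disproof.lean §0): NO TYPE-I BLOW-UP FOR CLAY DATA. Primary route
`TypeICertificateLadder`, sub-problem `NavierStokesRegularity` (Clay A, positive side). Crux-plan
skeleton by planner `cruxplan-stmt-NavierStokesRegularity-1217-killing-twisted-bern` (round 1, 2026-08-16)
for the idea card `Cruxes/Target/Ideas/killing-twisted-bernoulli-solitons.md` (triage r1-1/r1-2/r1-3: pass,
pass, pass — "stratum lever; plan as one line whose honest reach is the soliton stratum").

**Registered stubs (7).** External half (the complement of the stratum, NOT attacked by this line):
`stub_typeIBlowupGivesAncient` (A1, known mathematics, verbatim the shared item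
stmt-NavierStokesRegularity-1685 `MeanFieldTypeI.TypeIBlowupGivesAncient`) and `stub_solitonSelection`
(A2, OPEN, the "tangent-soliton" plug: a non-trivial Type-I ancient element forces a non-trivial Type-I
rotating soliton in Pineau–Vicol's class). Lever half (the idea): `stub_twistedHeadIdentity` (B1, the NEW
pointwise identity, CAS-verified), `stub_rotatingConjugateDensity` (B2, P–V Prop. 5.1 in the rotating
gauge), `stub_solitonLaws` (B3, the `C`-free soliton enstrophy law `∫|Ω|² m_α ≤ 4α²` and the identity
`∫|Ω|² m_α = 2α∫Ω₃ m_α`, from B1), `stub_weightedGapLemma` (B4, P–V Prop. 3.1 + Gaussian floor of `m_α`),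
`stub_windowLiouville` (B5, the STRATUM CRUX: soliton Liouville for `|α| ≥ a₀`, every `a₀ > 0`; known for
`|α| > ᾱ(C₀)` = P–V Thm 1.4, OPEN in the window `a₀ ≤ |α| ≤ ᾱ(C₀)` = P–V Conj. 1.1 "α ≈ 1").
The sorry-free compositions `rssLiouville_of_parts` (small `|α| ≤ √ε₀/2` closed by ARITHMETIC from
B2–B4 — payoff (i) of the card, an explicit small-α threshold — the rest handed to B5) and
`target_of_parts` (A1, A2 + soliton Liouville ⇒ the crux, by contradiction) give
`Target_of : Summit.NavierStokesRegularity.NavierStokesRegularity.Theses.ThreadingFlux.Target`, the ONLY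
theorem of this file whose stated conclusion is the crux decl BY NAME (`NoTypeIBlowup_of` re-types it as the
primary route's decl `TypeICertificateLadder.NoTypeIBlowup`, definitionally the same term).

## The line in one paragraph

For a Type-I rotated self-similar solution `u(x,t) = (−t)^{-1/2} R(αs) U(R(−αs)x/√−t)` (P–V (1.7),
`pvAnsatz α (fun y _ => U y)`; class of `pineauVicol2026_rss_liouville`: classical on `[−1,0)` with the
Type-I bound (1.10) `‖u(t,x)‖ ≤ C₀/(‖x‖+√−t)`), twist the Bernoulli head by the Killing density of the
rotation: `Π_α := P + ½|U|² + ½y·U − α⟪Jy, U⟫` (`J = rotGen`). With `L_α := −Δ + (U + ½y − αJy)·∇` the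
profile system (1.8) gives `L_α Π_α = −|Ω|² + 2αΩ₃` EXACTLY (B1; P–V's defect `αE` of (4.3) becomes the pure
divergence `2αΩ₃ = −2α∇·(JU)`). Pairing with the normalised positive kernel element `m_α` of `L_α*`
(`Δm + ∇·(m(U + ½y − αJy)) = 0`, two-sided Gaussian bounds with constants depending on `C₀` only, B2)
kills every transport term: `∫|Ω|² m_α = 2α∫Ω₃ m_α ≤ 2|α| (∫|Ω|² m_α)^{1/2}`, i.e. the `C`-FREE SOLITON
ENSTROPHY LAW `∫|Ω|² m_α ≤ 4α²` (B3). The Gaussian floor of `m_α` on `B_R̄` and P–V's gap lemma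
(Prop. 3.1: `‖Ω‖_{L²(B_R̄)} < C_Ω⁻¹ ⇒ U ≡ 0`, `R̄`, `C_Ω` α-free) give a weighted gap threshold
`ε₀(C₀)` (B4); hence `4α² ≤ ε₀ ⇒ U ≡ 0` — the small-α half of P–V Thm 1.4 with the EXPLICIT threshold
`|α| ≤ √ε₀/2` and no error term. For `|α| > √ε₀/2` the same identity reads
`∫|Ω|² m_α = α∫P ∂_θ m_α` (pressure torque against the ANGULAR FISHER INFORMATION of the conjugate density):
a soliton in the window must have a lopsided conjugate density yet a co-rotating coherent mean vorticity
(`⟨Ω₃⟩_{m_α} ≥ ⟨|Ω|²⟩_{m_α}/2α`, r.m.s. vorticity ≤ 2|α|) — B5 asks to turn this squeeze into Liouville for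
`|α| ≥ a₀`; P–V §6 (‖RU‖ ≪ 1/α, `R = J − ∂_θ`) does it for `|α| ≫ 1`; the window is open. The crux then
follows from the two external stubs: a Clay Type-I blow-up without extension yields a non-trivial Type-I
ancient mild solution (A1, Albritton–Barker/KNSS zoom, finite energy used here — Disproof §2), which by the
SOLITON SELECTION plug (A2) may be taken rotated self-similar in P–V's class — and those are trivial.

## Honest scope (read before picking this line)

This is a STRATUM line. Given B1–B5 (full soliton Liouville, itself open in the window), the crux is
EQUIVALENT to A2-type statements; A2 is the Navier–Stokes analogue of "Type-I singularities are modelled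
on shrinking solitons" (MCF: Huisken's monotonicity; Ricci: Perelman's reduced volume / Naber,
Enders–Müller–Topping), for which NS has no monotone quantity — it is implied by the Liouville conjecture
(L) for Type-I ancient mild solutions (then vacuous) and is not refutable without a non-trivial Type-I
ancient solution. The line OWNS B1–B5 (reach: Perelman–Tsai Conj. 8.9 = P–V Conj. 1.1 for all α, with an
explicit small-α threshold and a new conjugate identity in the window) and BORROWS A1 (known) and A2 (open,
external). Reshape options for the lead: (a) replace A2 by the weaker "breather selection" (RDSS instead of
RSS) at the price of one more open stub (the shape defect `⟨∂ₛP⟩` of the period-averaged law, card (iv));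
(b) drop A1–A2 and re-target the skeleton at a soliton-stratum item (`DulacContraction.RDSSLiouvilleInClass`,
`RecurrentProfiles.RecurrentLiouville`'s periodic rung) — then `Target_of` is lost and this becomes a module.

## Disproof used (Cruxes/Target/Disproof.lean, gen-2, 2026-08-15T23:37Z)

* §2 `target_false_without_lerayHopf` / `target_false_without_energy` (finite energy load-bearing): honoured
  at A1 — the zoom to a non-trivial ancient element uses the Leray–Hopf energy class (A–B Lemma 2.5, `𝐈 < ∞`);
  the drift flows of §§1–2 are not Leray–Hopf and never reach A2/B-stubs (P–V's class has the decaying bound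
  (1.10), which kills `u = a(t)e`).
* §3 `localTypeIRegularity_false_without_pressure`: honoured — every B-stub lives in the classical class with
  an explicit pressure (`IsClassicalNSSolutionOn … u p`; profile pressure `P = RᵢRⱼ(UᵢUⱼ)` up to a constant,
  P–V Lemma 2.1); no pressure-free class is used.
* §4 `target_selfSimilar` (α = 0 is settled: NRŠ/Tsai, tree `LeraySelfSimilarBlowupExclusion_holds`),
  `target_dss_near_one` (Chae–Wolf), `counterexample_not_axisymmetric` (KNSS): consistent — the stratum
  attacked here is `α ≠ 0` (B5's window), whose kernel `ker(J − ∂_θ)` = axisymmetric fields is exactly where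
  Type I is dead; `counterexample_typeI_constant_ge` / triage calibration `C ≥ 1.035`: not used (the soliton
  law is `C`-free).
* §6 normal form `target_iff_unit` (ν = T = 1): A1 is stated for general ν, T (verbatim stmt-1685); provers
  may normalise.
* No `_false_without_` theorem concerns profile-space hypotheses; no `Theorems/Target/Negative/` lemma has
  landed (none to import); negatives index: 1 unrelated entry (stmt-0154). No stub is an instance of a
  refuted statement.

## Conventions

`ℝ³ = EuclideanSpace ℝ (Fin 3)`; `rotGen v = (−v₁, v₀, 0) = e₃ × v` (P–V's `J`, (1.6)); `curl` with
`(curl U)₂ = ∂₀U₁ − ∂₁U₀ = Ω₃`; `headPressure (1/2) U P y = ½‖U y‖² + P y + ½⟪y, U y⟫`;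
`Laplacian.laplacian` = `Δ`; conjugate-density rates fixed at `ε = ¾` of P–V (5.3):
`c e^{−7|y|²/16} ≤ m ≤ M₁ e^{−|y|²/16}` (tree `PineauVicol2026.DriftHyp.exists_weight` allows `ε ∈ (½,1)`),
gradient rate `e^{−|y|²/32}` with a solution-dependent constant. All stub signatures are spelled out over
tree / Mathlib declarations only (no local definition occurs in a `stub_*` statement), so a Theorems file can
prove each by name + signature.
-/

noncomputable section

set_option linter.dupNamespace false
set_option linter.unusedVariables false

open Set Function MeasureTheory
open scoped BigOperators RealInnerProductSpace Laplacian ContDiff ENNReal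

namespace Summit.NavierStokesRegularity.NavierStokesRegularity.Cruxes.Target.KillingTwistedBernoulliSolitons

/-! ## Part A — external half (complement of the soliton stratum) — LEAD'S RESHAPE

A1 of the planner (`stub_typeIBlowupGivesAncient`, verbatim stmt-NavierStokesRegularity-1685) is no longer a
stub of this line: the Type-I zoom to the Oseen-gauge RATE class and the reduction of the crux to rate-class
Liouville are LANDED tree theorems (`Theorems.stub_typeIZoom`, p87903; `Theorems.noTypeIBlowup_of_rateClassLiouville`,
p94280), consumed directly by `NoTypeIBlowup_of` below. The only external stub is the selection plug A2'. -/

/-- **Stub A2' (registered; OPEN, EXTERNAL — the tangent-soliton plug, restated from the RATE class; XL).**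
SOLITON SELECTION: if the Oseen-gauge Type-I rate class at level `C > 0` — `IsTypeIAncientMild C v`: `v`
jointly smooth on `t < 0`, divergence free, Oseen-mild between all pairs of negative times (the KNSS gauge:
no parasitic `b(t)`, no Galilean frames), `‖v(t,x)‖ ≤ C/√(−t)` — has an element which is not identically
zero on `t < 0`, then there is a NON-TRIVIAL Type-I ROTATED SELF-SIMILAR solution in Pineau–Vicol's class:
`(u,p)` classical on `[−1,0)` with the Type-I bound (1.10) `‖u(t,x)‖ ≤ C₀/(‖x‖ + √−t)` for some `C₀ > 0`,
`u = pvAnsatz α (fun y _ => U y)` for some `α ∈ ℝ` and a `C²` profile `U ≠ 0` (exactly the hypothesis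
class of `pineauVicol2026_rss_liouville`). This is the NS analogue of "Type-I singularities are modelled on
shrinking solitons" (Huisken / Perelman–Naber in geometric flows, by monotonicity formulas NS does not
have) PLUS the apex decay (1.10) of the selected soliton (the time rate alone does not give
`|U| ≲ 1/(1+|y|)`; cf. `RellichScar.ApexLocalisation`, stmt-11719). It is the `σ ≠ 0` branch of the
infinitesimal-symmetry statement `SymmetryModuliCount.ForcedSymmetry` (stmt-NavierStokesRegularity-4052,
OPEN) sharpened by apex decay; it is implied by rate-class Liouville (then vacuous) and cannot be refuted
without a non-trivial Type-I ancient mild solution. The line does NOT attack it — it is the honest price of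
a stratum lever (triage r1-1/r1-3). Reshape (lead, 2026-08-16): hypothesis class changed from
Albritton–Barker's `K(C,M)` to the rate class `IsTypeIAncientMild C` (what the landed zoom delivers; no
`AlbrittonBarkerForward`). [cite: PineauVicol2026 Conj. 1.1, Remark 1.2; KNSS2009 §1, §6; Tsai2018 Conj. 8.9] -/
theorem stub_solitonSelection :
    ∀ (C : ℝ), 0 < C → ∀ (v : ℝ → EuclideanSpace ℝ (Fin 3) → EuclideanSpace ℝ (Fin 3)), Literature.Analysis.FluidPDE.IsTypeIAncientMild C v → ¬ (∀ t < 0, ∀ x, v t x = 0) → ∃ C₀ : ℝ, 0 < C₀ ∧ ∃ (α : ℝ) (u : ℝ → EuclideanSpace ℝ (Fin 3) → EuclideanSpace ℝ (Fin 3)) (p : ℝ → EuclideanSpace ℝ (Fin 3) → ℝ) (U : EuclideanSpace ℝ (Fin 3) → EuclideanSpace ℝ (Fin 3)), Literature.Analysis.FluidPDE.IsClassicalNSSolutionOn (Set.Ico (-1) 0) 1 0 u p ∧ (∀ t ∈ Set.Ico (-1 : ℝ) 0, ∀ x : EuclideanSpace ℝ (Fin 3), ‖u t x‖ ≤ C₀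 / (‖x‖ + Real.sqrt (-t))) ∧ ContDiff ℝ 2 U ∧ (∀ t ∈ Set.Ico (-1 : ℝ) 0, ∀ x : EuclideanSpace ℝ (Fin 3), u t x = Literature.Analysis.FluidPDE.pvAnsatz α (fun y _ => U y) t x) ∧ U ≠ 0 := by
  sorry

/-! ## Part B — the lever: Killing-twisted Bernoulli head and the soliton enstrophy law -/

/-- **Stub B1 (registered; the NEW identity; S–M in Lean, provable now).** KILLING-TWISTED HEAD IDENTITY:
for smooth divergence-free `U` and smooth `P` solving the rotated self-similar profile system (P–V (1.8a))
`α(JU − (Jy·∇)U) + ½U + ½(y·∇)U − ΔU + (U·∇)U + ∇P = 0`, the twisted head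
`Π_α = ½|U|² + P + ½⟪y,U⟫ − α⟪Jy,U⟫` satisfies, pointwise,
`−ΔΠ_α + DΠ_α[U + ½y − αJy] = −|curl U|² + 2α (curl U)₂`.
Proof route in tree: `PineauVicol2026.bernoulli_identity_rdss` with `Us = 0` gives
`LΠ = −|Ω|² + αE` ((4.3); the trace-form pressure equation `ΔP = −tr((∇U)²)` it asks for follows by taking
the divergence of (1.8a)); `∂_θΠ = ∂_θP + E` (`errorTerm_eq_half_dtheta`, (4.6)); and the new piece
`L⟪Jy,U⟫ = −∂_θP − 2Ω₃ + α∂_θ⟪Jy,U⟫` (uses `Δ⟪Jy,U⟫ = ⟪Jy,ΔU⟫ + 2Ω₃`, `⟪Jy,JU⟫ = y₀U₀ + y₁U₁`,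
`div((Jy·∇)U) = div(JU) = −Ω₃`). CAS-verified as an unconditional polynomial identity with remainder
`⟪U + ½y − αJy, F_RSS⟫ − (ΔP + tr((∇U)²))` (kit j005430 C1–C3b, j007038 T; re-run in this file's index
conventions: kit j009252). [cite: PineauVicol2026 (4.3)–(4.6) p. 11–12 (the α-defect); new: the twist] -/
theorem stub_twistedHeadIdentity :
    ∀ (α : ℝ) (U : EuclideanSpace ℝ (Fin 3) → EuclideanSpace ℝ (Fin 3)) (P : EuclideanSpace ℝ (Fin 3) → ℝ), ContDiff ℝ (⊤ : ℕ∞) U → ContDiff ℝ (⊤ : ℕ∞) P → Literature.Analysis.FluidPDE.VectorCalculus.IsDivFree U → (∀ y : EuclideanSpace ℝ (Fin 3), α • (Literature.Analysis.FluidPDE.rotGen (U y) - fderiv ℝ U y (Literature.Analysis.FluidPDE.rotGen y)) + (1 / 2 : ℝ) • U y + (1 / 2 : ℝ) • fderiv ℝ U y y - Laplacian.laplacian U y + fderiv ℝ U y (U y) + gradient P y = 0) → ∀ y : EuclideanSpace ℝ (Fin 3), -(Laplacian.laplacian (fun z => Literature.Analysis.FluidPDE.headPressure (1 / 2) U P z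 - α * inner ℝ (Literature.Analysis.FluidPDE.rotGen z) (U z)) y) + fderiv ℝ (fun z => Literature.Analysis.FluidPDE.headPressure (1 / 2) U P z - α * inner ℝ (Literature.Analysis.FluidPDE.rotGen z) (U z)) y (U y + (1 / 2 : ℝ) • y - α • Literature.Analysis.FluidPDE.rotGen y) = -‖Literature.Analysis.FluidPDE.curl U y‖ ^ 2 + 2 * α * (Literature.Analysis.FluidPDE.curl U y) 2 :=
  -- LANDED (p97091): the registered stub, proved in the tree under `Theorems`
  Summit.NavierStokesRegularity.NavierStokesRegularity.Theorems.stub_twistedHeadIdentity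

/-- **Stub B2 (registered; M–L, provable from tree material).** ROTATING CONJUGATE DENSITY: for every Type-I
constant `C₀ > 0` and every bound `A ≥ 0` on the rotation rate there are `c, M₁ > 0` (depending on `C₀, A`
only — uniform on compact α-ranges; α-uniformity is plausible since the barriers are radial, but the Harnack
chain sees `|α||y|`, so it is not claimed) such that every Type-I RSS solution of P–V's class with profile `U`
and angular speed `|α| ≤ A` admits a `C²`, strictly positive, normalised
(`∫ m = 1`) kernel element `m = m_α` of the adjoint of `L_α = −Δ + (U + ½y − αJy)·∇`, i.e.
`Δm + ∇·(m (U + ½y − αJy)) = 0` (stationary Fokker–Planck equation of the rotating-frame diffusion), with the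
two-sided Gaussian bounds `c e^{−7|y|²/16} ≤ m ≤ M₁ e^{−|y|²/16}` and a Gaussian gradient bound (solution-
dependent constant). Why plausibly true: P–V Prop. 5.1 is PROVED in tree for bounded divergence-free drifts
with `|⟪U,y⟫| ≤ C₀` (`PineauVicol2026.DriftHyp.exists_weight`, ε ∈ (½,1), whole-space Lax–Milgram/Fredholm
on `H¹(γ)` + Hörmander + Hopf + Harnack chains + the radial barriers (5.6)–(5.9)); the extra drift `−αJy` is
tangential (`⟪Jy,y⟫ = 0`: the radial barriers and the Lyapunov function `|y|²` are blind to it),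
divergence-free, skew on `L²(γ)` (coercivity unchanged) and `|y|`-bounded on `H¹(γ)` (Hermite structure);
normalising `∫m = 1` instead of `m(0) = 1` only rescales `c, M₁` by `C₀`-dependent factors. The profile is
smooth with (1.9), (2.1) by P–V Lemma 2.1 (α-free constants). Degenerate check: `U = 0 ⇒ m = (4π)^{-3/2}
e^{−|y|²/4}` for every `α`. [cite: PineauVicol2026 Prop. 5.1, (5.2)–(5.3), Remark 5.2, Lemma 2.1] -/
theorem stub_rotatingConjugateDensity :
    ∀ C₀ : ℝ, 0 < C₀ → ∀ A : ℝ, 0 ≤ A → ∃ c M₁ : ℝ, 0 < c ∧ 0 < M₁ ∧ ∀ (α : ℝ) (u : ℝ → EuclideanSpace ℝ (Fin 3) → EuclideanSpace ℝ (Fin 3)) (p : ℝ → EuclideanSpace ℝ (Fin 3) → ℝ) (U : EuclideanSpace ℝ (Fin 3) → EuclideanSpace ℝ (Fin 3)), |α| ≤ A → Literature.Analysis.FluidPDE.IsClassicalNSSolutionOn (Set.Ico (-1) 0) 1 0 u p → (∀ t ∈ Set.Ico (-1 : ℝ) 0, ∀ x : EuclideanSpace ℝ (Fin 3), ‖u t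 x‖ ≤ C₀ / (‖x‖ + Real.sqrt (-t))) → ContDiff ℝ 2 U → (∀ t ∈ Set.Ico (-1 : ℝ) 0, ∀ x : EuclideanSpace ℝ (Fin 3), u t x = Literature.Analysis.FluidPDE.pvAnsatz α (fun y _ => U y) t x) → ∃ m : EuclideanSpace ℝ (Fin 3) → ℝ, ContDiff ℝ 2 m ∧ (∀ y, 0 < m y) ∧ (∫ y, m y = 1) ∧ (∀ y, c * Real.exp (-(7 / 16 : ℝ) * ‖y‖ ^ 2) ≤ m y) ∧ (∀ y, m y ≤ M₁ * Real.exp (-(1 / 16 : ℝ) * ‖y‖ ^ 2)) ∧ (∃ M₂ : ℝ, ∀ y, ‖fderiv ℝ m y‖ ≤ M₂ * Real.exp (-(1 / 32 : ℝ) * ‖y‖ ^ 2)) ∧ (∀ y, Laplacian.laplacian m y + Literature.Analysis.FluidPDE.VectorCalculus.divergence (fun z => m z • (U z + (1 / 2 : ℝ) • z - α • Literature.Analysis.FluidPDE.rotGen z)) y = 0) :=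
  -- LANDED (p105556): the registered stub, proved in the tree under `Theorems`
  Summit.NavierStokesRegularity.NavierStokesRegularity.Theorems.stub_rotatingConjugateDensity

/-- **Stub B3 (registered; M).** THE SOLITON LAWS from the twisted identity: given the pointwise identity of
B1 (hypothesis, verbatim), every Type-I RSS solution of P–V's class (profile `U`, speed `α`) and every
conjugate density `m` as in B2 satisfy
(LAW) `∫ |curl U|² m ≤ 4α²` — `C₀`-FREE — and (IDENTITY) `∫ |curl U|² m = 2α ∫ (curl U)₂ m`.
Proof: `U = u(−1,·)` is smooth and, with the profile pressure `P := p(−1,·)` (any gauge), solves (1.8a)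
(substitute the ansatz at `t = −1`, where `s = 0`, `R(0) = 1`; P–V footnote 13 for the one-sided time
derivative); `Π_α` has linear growth ((1.9), (2.2): `|Π_α| ≤ C_P + ½C₀² + (½ + |α|)C₀(1+|y|)`), `∇Π_α`
polynomial growth, so the whole-space pairing `∫ (−ΔΠ_α + DΠ_α[b_α]) m = −∫ Π_α (Δm + ∇·(m b_α)) = 0` is
justified by the Gaussian bounds on `m, ∇m` (tree pattern `PineauVicol2026.integral_weight_mul_drift_eq_zero`,
P–V (5.4) and fn. 16); B1 turns it into the IDENTITY; Cauchy–Schwarz in the probability `m dy` and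
`(curl U)₂² ≤ |curl U|²` give `∫|Ω|²m ≤ 2|α| (∫|Ω|²m)^{1/2}`, i.e. the LAW. Second (torque) form, for B5's
provers: `2α∫Ω₃ m = α∫ P ∂_θ m` (`∂_θ = (Jy)·∇`; from `L_α⟪Jy,U⟫ = −∂_θP − 2Ω₃`). Degenerate checks:
`α = 0` ⇒ `∫|Ω|²m = 0` ⇒ NRŠ/Tsai; `U = 0` ⇒ `0 ≤ 4α²`. [cite: PineauVicol2026 (5.4), fn. 16, Lemma 2.1;
card killing-twisted-bernoulli-solitons K2] -/
theorem stub_solitonLaws :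
    (∀ (α : ℝ) (U : EuclideanSpace ℝ (Fin 3) → EuclideanSpace ℝ (Fin 3)) (P : EuclideanSpace ℝ (Fin 3) → ℝ), ContDiff ℝ (⊤ : ℕ∞) U → ContDiff ℝ (⊤ : ℕ∞) P → Literature.Analysis.FluidPDE.VectorCalculus.IsDivFree U → (∀ y : EuclideanSpace ℝ (Fin 3), α • (Literature.Analysis.FluidPDE.rotGen (U y) - fderiv ℝ U y (Literature.Analysis.FluidPDE.rotGen y)) + (1 / 2 : ℝ) • U y + (1 / 2 : ℝ) • fderiv ℝ U y y - Laplacian.laplacian U y + fderiv ℝ U y (U y) + gradient P y = 0) → ∀ y : EuclideanSpace ℝ (Fin 3), -(Laplacian.laplacian (fun z => Literature.Analysis.FluidPDE.headPressure (1 / 2) U P z - α * inner ℝ (Literature.Analysis.FluidPDE.rotGen z) (U z)) y) + fderiv ℝ (fun z => Literature.Analysis.FluidPDE.headPressure (1 / 2) U P z - α * inner ℝ (Literature.Analysis.FluidPDE.rotGen z) (U z)) y (U y + (1 / 2 : ℝ) • y - α • Literature.Analysis.FluidPDE.rotGen y) = -‖Literature.Analysis.FluidPDE.curl U y‖ ^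 2 + 2 * α * (Literature.Analysis.FluidPDE.curl U y) 2) →
    ∀ (C₀ α : ℝ) (u : ℝ → EuclideanSpace ℝ (Fin 3) → EuclideanSpace ℝ (Fin 3)) (p : ℝ → EuclideanSpace ℝ (Fin 3) → ℝ) (U : EuclideanSpace ℝ (Fin 3) → EuclideanSpace ℝ (Fin 3)) (m : EuclideanSpace ℝ (Fin 3) → ℝ) (c M₁ : ℝ), Literature.Analysis.FluidPDE.IsClassicalNSSolutionOn (Set.Ico (-1) 0) 1 0 u p → (∀ t ∈ Set.Ico (-1 : ℝ) 0, ∀ x : EuclideanSpace ℝ (Fin 3), ‖u t x‖ ≤ C₀ / (‖x‖ + Real.sqrt (-t))) → ContDiff ℝ 2 U → (∀ t ∈ Set.Ico (-1 : ℝ) 0, ∀ x : EuclideanSpace ℝ (Fin 3), u t x = Literature.Analysis.FluidPDE.pvAnsatz α (fun y _ => U y) t x) → (ContDiff ℝ 2 m ∧ (∀ y, 0 < m y) ∧ (∫ y, m y = 1) ∧ (∀ y, c * Real.exp (-(7 / 16 : ℝ) * ‖y‖ ^ 2) ≤ m y) ∧ (∀ y, m y ≤ M₁ * Real.exp (-(1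 / 16 : ℝ) * ‖y‖ ^ 2)) ∧ (∃ M₂ : ℝ, ∀ y, ‖fderiv ℝ m y‖ ≤ M₂ * Real.exp (-(1 / 32 : ℝ) * ‖y‖ ^ 2)) ∧ (∀ y, Laplacian.laplacian m y + Literature.Analysis.FluidPDE.VectorCalculus.divergence (fun z => m z • (U z + (1 / 2 : ℝ) • z - α • Literature.Analysis.FluidPDE.rotGen z)) y = 0)) → (∫ y, ‖Literature.Analysis.FluidPDE.curl U y‖ ^ 2 * m y ≤ 4 * α ^ 2) ∧ (∫ y, ‖Literature.Analysis.FluidPDE.curl U y‖ ^ 2 * m y = 2 * α * ∫ y, (Literature.Analysis.FluidPDE.curl U y) 2 * m y) :=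
  -- LANDED (p101267): the registered stub, proved in the tree under `Theorems`
  Summit.NavierStokesRegularity.NavierStokesRegularity.Theorems.stub_solitonLaws

/-- **Stub B4 (registered; M, provable from tree material).** WEIGHTED GAP LEMMA: for `C₀ > 0` and
conjugate constants `c, M₁ > 0` there is `ε₀ = ε₀(C₀, c, M₁) > 0` such that a Type-I RSS solution of P–V's
class whose profile has conjugate enstrophy `∫|curl U|² m ≤ ε₀` (for some conjugate density `m` with the B2
bounds) is trivial. Proof: P–V Lemma 2.1 gives the α-free gradient decay `|∇U| ≤ C_{U,1}(C₀)/(1+|y|²)`, so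
with `R̄ = √(8C_{U,1})`, `‖Ω‖²_{L²(B_R̄)} ≤ (c e^{−7R̄²/16})^{-1} ∫|Ω|²m ≤ ε₀ e^{7R̄²/16}/c`; choose
`ε₀ := c e^{−7R̄²/16} C_Ω^{-2}/2` and apply P–V Prop. 3.1 (gap lemma: `‖Ω‖_{L²(B_R̄)} < C_Ω^{-1} ⇒ Ω ≡ 0`,
universal `C_Ω`; α-free form PROVED in tree as `PineauVicol2026.curl_eq_zero_of_small_local_enstrophy`,
period `S` arbitrary for a steady profile) and `Ω ≡ 0 ⇒ U ≡ 0` (tree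
`PineauVicol2026.profile_slice_eq_zero_of_curl_eq_zero`). [cite: PineauVicol2026 Prop. 3.1, (3.2), proof of
Thm 1.4 small-α case p. 13, Lemma 2.1] -/
theorem stub_weightedGapLemma :
    ∀ C₀ : ℝ, 0 < C₀ → ∀ c M₁ : ℝ, 0 < c → 0 < M₁ → ∃ ε₀ : ℝ, 0 < ε₀ ∧ ∀ (α : ℝ) (u : ℝ → EuclideanSpace ℝ (Fin 3) → EuclideanSpace ℝ (Fin 3)) (p : ℝ → EuclideanSpace ℝ (Fin 3) → ℝ) (U : EuclideanSpace ℝ (Fin 3) → EuclideanSpace ℝ (Fin 3)) (m : EuclideanSpace ℝ (Fin 3) → ℝ), Literature.Analysis.FluidPDE.IsClassicalNSSolutionOn (Set.Ico (-1) 0) 1 0 u p → (∀ t ∈ Set.Ico (-1 : ℝ) 0, ∀ x : EuclideanSpace ℝ (Fin 3), ‖u t x‖ ≤ C₀ / (‖x‖ + Real.sqrt (-t))) → ContDiff ℝ 2 U → (∀ t ∈ Set.Ico (-1 : ℝ) 0, ∀ x : EuclideanSpace ℝ (Fin 3), u t x = Literature.Analysis.FluidPDE.pvAnsatz α (fun y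 _ => U y) t x) → (ContDiff ℝ 2 m ∧ (∀ y, 0 < m y) ∧ (∫ y, m y = 1) ∧ (∀ y, c * Real.exp (-(7 / 16 : ℝ) * ‖y‖ ^ 2) ≤ m y) ∧ (∀ y, m y ≤ M₁ * Real.exp (-(1 / 16 : ℝ) * ‖y‖ ^ 2)) ∧ (∃ M₂ : ℝ, ∀ y, ‖fderiv ℝ m y‖ ≤ M₂ * Real.exp (-(1 / 32 : ℝ) * ‖y‖ ^ 2)) ∧ (∀ y, Laplacian.laplacian m y + Literature.Analysis.FluidPDE.VectorCalculus.divergence (fun z => m z • (U z + (1 / 2 : ℝ) • z - α • Literature.Analysis.FluidPDE.rotGen z)) y = 0)) → (∫ y, ‖Literature.Analysis.FluidPDE.curl U y‖ ^ 2 * m y ≤ ε₀) → U = 0 :=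
  -- LANDED (p100133): the registered stub, proved in the tree under `Theorems`
  Summit.NavierStokesRegularity.NavierStokesRegularity.Theorems.stub_weightedGapLemma

/-- **Stub B5b (registered; THE STRATUM CRUX in a COMPACT WINDOW — hardest stub the line owns; OPEN).**
WINDOW LIOUVILLE FOR TYPE-I SOLITONS (lead's reshape 2026-08-16 of the planner's B5, which asked for all
`|α| ≥ a₀`): for every `C₀ > 0` and every compact window `0 < a₀ ≤ |α| ≤ A₀`, a Type-I RSS solution of
P–V's class with rotation rate in the window, equipped with a conjugate density `m` (B2 bounds) obeying the
soliton LAW and IDENTITY of B3 (hypotheses supplied by B2/B3 in the composition; they are the tools, not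
restrictions), has `U = 0`. Why only a window is left: the extreme regimes `|α| < α₁(C₀)` and
`|α| > α₂(C₀)` are the TREE THEOREM `pineauVicol2026_rss_liouville_holds` (P–V Thm 1.4, discharged), and
the composition `rssLiouville_of_parts` uses them (and the explicit small branch B2–B4) before calling this
stub, so only `max(α₁, √ε₀/2) ≤ |α| ≤ α₂` is ever asked. Status: this is Perelman–Tsai Conj. 8.9 = P–V
Conj. 1.1 in a compact window of rotation rates ("leaves open the case α ≈ 1") — OPEN; no size information on
`α₁, α₂` is available (compactness proofs). The line's proposed squeeze (card (iii)): by B3's torque form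
`∫|Ω|²m = α∫P ∂_θ m ≤ |α| ‖P‖_∞ I_θ(m)^{1/2}` (angular Fisher information `I_θ(m) = ∫|∂_θ log m|² m`), a
window soliton needs a lopsided conjugate density — sourced only by the non-axisymmetric part `RU`
(`RU = 0 ⇒ ∂_θ m_α = 0`, and axisymmetric Type-I profiles are dead by KNSS) — AND a co-rotating coherent mean
vorticity `⟨Ω₃⟩_m ≥ ⟨|Ω|²⟩_m/2α > 0` of r.m.s. size `≤ 2|α| ≤ 2A₀`; wanted: a kernel-perturbation bound
`‖∂_θ log m_α‖_{L²(m_α)} ≲_{C₀,A₀} ‖RU‖` plus a quantitative axisymmetric Liouville. WHY IT MIGHT FAIL: at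
`α ≈ 1` nothing is small; a non-trivial soliton in the window (P–V Conj. 1.1 false) refutes B5b and is a
Type-I blow-up profile. Degenerate check: hypotheses are met by `U = 0`, `m =` Gaussian. [cite: PineauVicol2026
Thm 1.4, Conj. 1.1, §6; Tsai2018 Conj. 8.9; BradshawTsai2017CPDE OP 5.2] -/
theorem stub_windowLiouville :
    ∀ C₀ : ℝ, 0 < C₀ → ∀ a₀ A₀ : ℝ, 0 < a₀ → a₀ ≤ A₀ → ∀ α : ℝ, a₀ ≤ |α| → |α| ≤ A₀ → ∀ (u : ℝ → EuclideanSpace ℝ (Fin 3) → EuclideanSpace ℝ (Fin 3)) (p : ℝ → EuclideanSpace ℝ (Fin 3) → ℝ) (U : EuclideanSpace ℝ (Fin 3) → EuclideanSpace ℝ (Fin 3)) (m : EuclideanSpace ℝ (Fin 3) → ℝ) (c M₁ : ℝ), Literature.Analysis.FluidPDE.IsClassicalNSSolutionOn (Set.Ico (-1) 0) 1 0 u p → (∀ t ∈ Set.Ico (-1 : ℝ) 0, ∀ x : EuclideanSpace ℝ (Fin 3), ‖u t x‖ ≤ C₀ / (‖x‖ + Real.sqrt (-t))) → ContDiff ℝ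 2 U → (∀ t ∈ Set.Ico (-1 : ℝ) 0, ∀ x : EuclideanSpace ℝ (Fin 3), u t x = Literature.Analysis.FluidPDE.pvAnsatz α (fun y _ => U y) t x) → 0 < c → 0 < M₁ → (ContDiff ℝ 2 m ∧ (∀ y, 0 < m y) ∧ (∫ y, m y = 1) ∧ (∀ y, c * Real.exp (-(7 / 16 : ℝ) * ‖y‖ ^ 2) ≤ m y) ∧ (∀ y, m y ≤ M₁ * Real.exp (-(1 / 16 : ℝ) * ‖y‖ ^ 2)) ∧ (∃ M₂ : ℝ, ∀ y, ‖fderiv ℝ m y‖ ≤ M₂ * Real.exp (-(1 / 32 : ℝ) * ‖y‖ ^ 2)) ∧ (∀ y, Laplacian.laplacian m y + Literature.Analysis.FluidPDE.VectorCalculus.divergence (fun z => m z • (U z + (1 / 2 : ℝ) • z - α • Literature.Analysis.FluidPDE.rotGen z)) y = 0)) → (∫ y, ‖Literature.Analysis.FluidPDE.curl U y‖ ^ 2 * m y ≤ 4 * α ^ 2) → (∫ y, ‖Literature.Analysis.FluidPDE.curl U y‖ ^ 2 * m y = 2 * α * ∫ y, (Literature.Analysis.FluidPDE.curl U y) 2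 * m y) → U = 0 := by
  sorry

/-! ## Part C — compositions (sorry-free) -/

/-- **Soliton Liouville for ALL α from B1–B5b and the tree's Theorem 1.4 (proved composition; lead's
reshape).** For every `C₀ > 0`, every Type-I RSS solution of P–V's class is trivial: if `|α| < α₁(C₀)` or
`|α| > α₂(C₀)` this is the TREE THEOREM `pineauVicol2026_rss_liouville_holds` (P–V Thm 1.4); otherwise B2
(with `A := |α|`) gives the conjugate density and its constants, B3 (fed with B1) the law `∫|Ω|²m ≤ 4α²` and
the identity, B4 the threshold `ε₀(C₀,c,M₁)`; if `4α² ≤ ε₀` the gap lemma concludes (explicit small-α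
branch), otherwise `√ε₀/2 ≤ |α| ≤ α₂` by real arithmetic and the WINDOW stub B5b (with `a₀ := √ε₀/2`,
`A₀ := α₂`) concludes. Stated over the hypothesis list of `pineauVicol2026_rss_liouville` WITHOUT its
`|α| < α₁ ∨ α₂ < |α|` restriction (= P–V Conj. 1.1 in their class, all α). -/
theorem rssLiouville_of_parts
    (h1 : ∀ (α : ℝ) (U : EuclideanSpace ℝ (Fin 3) → EuclideanSpace ℝ (Fin 3)) (P : EuclideanSpace ℝ (Fin 3) → ℝ), ContDiff ℝ (⊤ : ℕ∞) U → ContDiff ℝ (⊤ : ℕ∞) P → Literature.Analysis.FluidPDE.VectorCalculus.IsDivFree U → (∀ y : EuclideanSpace ℝ (Fin 3), α • (Literature.Analysis.FluidPDE.rotGen (U y) - fderiv ℝ U y (Literature.Analysis.FluidPDE.rotGen y)) + (1 / 2 : ℝ) • U y + (1 / 2 : ℝ) • fderiv ℝ U y y - Laplacian.laplacian U y + fderiv ℝ U y (U y) + gradient P y = 0) → ∀ y : EuclideanSpace ℝ (Fin 3), -(Laplacian.laplacian (fun z => Literature.Analysis.FluidPDE.headPressure (1 / 2) U P z - α * inner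 ℝ (Literature.Analysis.FluidPDE.rotGen z) (U z)) y) + fderiv ℝ (fun z => Literature.Analysis.FluidPDE.headPressure (1 / 2) U P z - α * inner ℝ (Literature.Analysis.FluidPDE.rotGen z) (U z)) y (U y + (1 / 2 : ℝ) • y - α • Literature.Analysis.FluidPDE.rotGen y) = -‖Literature.Analysis.FluidPDE.curl U y‖ ^ 2 + 2 * α * (Literature.Analysis.FluidPDE.curl U y) 2)
    (h2 : ∀ C₀ : ℝ, 0 < C₀ → ∀ A : ℝ, 0 ≤ A → ∃ c M₁ : ℝ, 0 < c ∧ 0 < M₁ ∧ ∀ (α : ℝ) (u : ℝ → EuclideanSpace ℝ (Fin 3) → EuclideanSpace ℝ (Fin 3)) (p : ℝ → EuclideanSpace ℝ (Fin 3) → ℝ) (U : EuclideanSpace ℝ (Fin 3) → EuclideanSpace ℝ (Fin 3)), |α| ≤ A → Literature.Analysis.FluidPDE.IsClassicalNSSolutionOn (Set.Ico (-1) 0) 1 0 u p → (∀ t ∈ Set.Ico (-1 : ℝ) 0, ∀ x : EuclideanSpace ℝ (Fin 3), ‖u t x‖ ≤ C₀ / (‖x‖ + Real.sqrt (-t)))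 → ContDiff ℝ 2 U → (∀ t ∈ Set.Ico (-1 : ℝ) 0, ∀ x : EuclideanSpace ℝ (Fin 3), u t x = Literature.Analysis.FluidPDE.pvAnsatz α (fun y _ => U y) t x) → ∃ m : EuclideanSpace ℝ (Fin 3) → ℝ, ContDiff ℝ 2 m ∧ (∀ y, 0 < m y) ∧ (∫ y, m y = 1) ∧ (∀ y, c * Real.exp (-(7 / 16 : ℝ) * ‖y‖ ^ 2) ≤ m y) ∧ (∀ y, m y ≤ M₁ * Real.exp (-(1 / 16 : ℝ) * ‖y‖ ^ 2)) ∧ (∃ M₂ : ℝ, ∀ y, ‖fderiv ℝ m y‖ ≤ M₂ * Real.exp (-(1 / 32 : ℝ) * ‖y‖ ^ 2)) ∧ (∀ y, Laplacian.laplacian m y + Literature.Analysis.FluidPDE.VectorCalculus.divergence (fun z => m z • (U z + (1 / 2 : ℝ) • z - α • Literature.Analysis.FluidPDE.rotGen z)) y = 0))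
    (h3 : (∀ (α : ℝ) (U : EuclideanSpace ℝ (Fin 3) → EuclideanSpace ℝ (Fin 3)) (P : EuclideanSpace ℝ (Fin 3) → ℝ), ContDiff ℝ (⊤ : ℕ∞) U → ContDiff ℝ (⊤ : ℕ∞) P → Literature.Analysis.FluidPDE.VectorCalculus.IsDivFree U → (∀ y : EuclideanSpace ℝ (Fin 3), α • (Literature.Analysis.FluidPDE.rotGen (U y) - fderiv ℝ U y (Literature.Analysis.FluidPDE.rotGen y)) + (1 / 2 : ℝ) • U y + (1 / 2 : ℝ) • fderiv ℝ U y y - Laplacian.laplacian U y + fderiv ℝ U y (U y) + gradient P y = 0) → ∀ y : EuclideanSpace ℝ (Fin 3), -(Laplacian.laplacian (fun z => Literature.Analysis.FluidPDE.headPressure (1 / 2) U P z - α * inner ℝ (Literature.Analysis.FluidPDE.rotGen z) (U z)) y) + fderiv ℝ (fun z => Literature.Analysis.FluidPDE.headPressure (1 / 2) U P z - α * inner ℝ (Literature.Analysis.FluidPDE.rotGen z) (U z)) y (U y + (1 / 2 : ℝ) • y - α • Literature.Analysis.FluidPDE.rotGen y) = -‖Literature.Analysis.FluidPDE.curl U y‖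 ^ 2 + 2 * α * (Literature.Analysis.FluidPDE.curl U y) 2) →
    ∀ (C₀ α : ℝ) (u : ℝ → EuclideanSpace ℝ (Fin 3) → EuclideanSpace ℝ (Fin 3)) (p : ℝ → EuclideanSpace ℝ (Fin 3) → ℝ) (U : EuclideanSpace ℝ (Fin 3) → EuclideanSpace ℝ (Fin 3)) (m : EuclideanSpace ℝ (Fin 3) → ℝ) (c M₁ : ℝ), Literature.Analysis.FluidPDE.IsClassicalNSSolutionOn (Set.Ico (-1) 0) 1 0 u p → (∀ t ∈ Set.Ico (-1 : ℝ) 0, ∀ x : EuclideanSpace ℝ (Fin 3), ‖u t x‖ ≤ C₀ / (‖x‖ + Real.sqrt (-t))) → ContDiff ℝ 2 U → (∀ t ∈ Set.Ico (-1 : ℝ) 0, ∀ x : EuclideanSpace ℝ (Fin 3), u t x = Literature.Analysis.FluidPDE.pvAnsatz α (fun y _ => U y) t x) → (ContDiff ℝ 2 m ∧ (∀ y, 0 < m y) ∧ (∫ y, m y = 1) ∧ (∀ y, c * Real.exp (-(7 / 16 : ℝ) * ‖y‖ ^ 2) ≤ m y) ∧ (∀ y, m y ≤ M₁ * Real.exp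 (-(1 / 16 : ℝ) * ‖y‖ ^ 2)) ∧ (∃ M₂ : ℝ, ∀ y, ‖fderiv ℝ m y‖ ≤ M₂ * Real.exp (-(1 / 32 : ℝ) * ‖y‖ ^ 2)) ∧ (∀ y, Laplacian.laplacian m y + Literature.Analysis.FluidPDE.VectorCalculus.divergence (fun z => m z • (U z + (1 / 2 : ℝ) • z - α • Literature.Analysis.FluidPDE.rotGen z)) y = 0)) → (∫ y, ‖Literature.Analysis.FluidPDE.curl U y‖ ^ 2 * m y ≤ 4 * α ^ 2) ∧ (∫ y, ‖Literature.Analysis.FluidPDE.curl U y‖ ^ 2 * m y = 2 * α * ∫ y, (Literature.Analysis.FluidPDE.curl U y) 2 * m y))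
    (h4 : ∀ C₀ : ℝ, 0 < C₀ → ∀ c M₁ : ℝ, 0 < c → 0 < M₁ → ∃ ε₀ : ℝ, 0 < ε₀ ∧ ∀ (α : ℝ) (u : ℝ → EuclideanSpace ℝ (Fin 3) → EuclideanSpace ℝ (Fin 3)) (p : ℝ → EuclideanSpace ℝ (Fin 3) → ℝ) (U : EuclideanSpace ℝ (Fin 3) → EuclideanSpace ℝ (Fin 3)) (m : EuclideanSpace ℝ (Fin 3) → ℝ), Literature.Analysis.FluidPDE.IsClassicalNSSolutionOn (Set.Ico (-1) 0) 1 0 u p → (∀ t ∈ Set.Ico (-1 : ℝ) 0, ∀ x : EuclideanSpace ℝ (Fin 3), ‖u t x‖ ≤ C₀ / (‖x‖ + Real.sqrt (-t))) → ContDiff ℝ 2 U → (∀ t ∈ Set.Ico (-1 : ℝ) 0, ∀ x : EuclideanSpace ℝ (Fin 3), u t x = Literature.Analysis.FluidPDE.pvAnsatz α (fun y _ => U y) t x) → (ContDiff ℝ 2 m ∧ (∀ y, 0 < m y) ∧ (∫ y, m y = 1) ∧ (∀ y, c * Real.exp (-(7 / 16 : ℝ) * ‖y‖ ^ 2) ≤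 m y) ∧ (∀ y, m y ≤ M₁ * Real.exp (-(1 / 16 : ℝ) * ‖y‖ ^ 2)) ∧ (∃ M₂ : ℝ, ∀ y, ‖fderiv ℝ m y‖ ≤ M₂ * Real.exp (-(1 / 32 : ℝ) * ‖y‖ ^ 2)) ∧ (∀ y, Laplacian.laplacian m y + Literature.Analysis.FluidPDE.VectorCalculus.divergence (fun z => m z • (U z + (1 / 2 : ℝ) • z - α • Literature.Analysis.FluidPDE.rotGen z)) y = 0)) → (∫ y, ‖Literature.Analysis.FluidPDE.curl U y‖ ^ 2 * m y ≤ ε₀) → U = 0)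
    (h5 : ∀ C₀ : ℝ, 0 < C₀ → ∀ a₀ A₀ : ℝ, 0 < a₀ → a₀ ≤ A₀ → ∀ α : ℝ, a₀ ≤ |α| → |α| ≤ A₀ → ∀ (u : ℝ → EuclideanSpace ℝ (Fin 3) → EuclideanSpace ℝ (Fin 3)) (p : ℝ → EuclideanSpace ℝ (Fin 3) → ℝ) (U : EuclideanSpace ℝ (Fin 3) → EuclideanSpace ℝ (Fin 3)) (m : EuclideanSpace ℝ (Fin 3) → ℝ) (c M₁ : ℝ), Literature.Analysis.FluidPDE.IsClassicalNSSolutionOn (Set.Ico (-1) 0) 1 0 u p → (∀ t ∈ Set.Ico (-1 : ℝ) 0, ∀ x : EuclideanSpace ℝ (Fin 3), ‖u t x‖ ≤ C₀ / (‖x‖ + Real.sqrt (-t))) → ContDiff ℝ 2 U → (∀ t ∈ Set.Ico (-1 : ℝ) 0, ∀ x : EuclideanSpace ℝ (Fin 3), u t x = Literature.Analysis.FluidPDE.pvAnsatz α (fun y _ => U y) t x) → 0 < c → 0 < M₁ → (ContDiff ℝ 2 m ∧ (∀ y, 0 < m y) ∧ (∫ y, m y = 1) ∧ (∀ y, c *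 Real.exp (-(7 / 16 : ℝ) * ‖y‖ ^ 2) ≤ m y) ∧ (∀ y, m y ≤ M₁ * Real.exp (-(1 / 16 : ℝ) * ‖y‖ ^ 2)) ∧ (∃ M₂ : ℝ, ∀ y, ‖fderiv ℝ m y‖ ≤ M₂ * Real.exp (-(1 / 32 : ℝ) * ‖y‖ ^ 2)) ∧ (∀ y, Laplacian.laplacian m y + Literature.Analysis.FluidPDE.VectorCalculus.divergence (fun z => m z • (U z + (1 / 2 : ℝ) • z - α • Literature.Analysis.FluidPDE.rotGen z)) y = 0)) → (∫ y, ‖Literature.Analysis.FluidPDE.curl U y‖ ^ 2 * m y ≤ 4 * α ^ 2) → (∫ y, ‖Literature.Analysis.FluidPDE.curl U y‖ ^ 2 * m y = 2 * α * ∫ y, (Literature.Analysis.FluidPDE.curl U y) 2 * m y) → U = 0) :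
    ∀ C₀ : ℝ, 0 < C₀ → ∀ (α : ℝ) (u : ℝ → EuclideanSpace ℝ (Fin 3) → EuclideanSpace ℝ (Fin 3)) (p : ℝ → EuclideanSpace ℝ (Fin 3) → ℝ) (U : EuclideanSpace ℝ (Fin 3) → EuclideanSpace ℝ (Fin 3)), Literature.Analysis.FluidPDE.IsClassicalNSSolutionOn (Set.Ico (-1) 0) 1 0 u p → (∀ t ∈ Set.Ico (-1 : ℝ) 0, ∀ x : EuclideanSpace ℝ (Fin 3), ‖u t x‖ ≤ C₀ / (‖x‖ + Real.sqrt (-t))) → ContDiff ℝ 2 U → (∀ t ∈ Set.Ico (-1 : ℝ) 0, ∀ x : EuclideanSpace ℝ (Fin 3), u t x = Literature.Analysis.FluidPDE.pvAnsatz α (fun y _ => U y) t x) → U = 0 := by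
  intro C₀ hC₀ α u p U hns hI hU hA
  -- the two extreme regimes are the tree's Theorem 1.4 (Pineau–Vicol 2026, discharged)
  obtain ⟨α₁, α₂, hα₁, hα₂, hPV⟩ :=
    Literature.Analysis.FluidPDE.pineauVicol2026_rss_liouville_holds C₀ hC₀
  by_cases hext : |α| < α₁ ∨ α₂ < |α|
  · exact hPV α u p U hns hI hU hA hext
  have hαle : |α| ≤ α₂ := le_of_not_gt fun h => hext (Or.inr h)
  -- the explicit small branch (B2–B4) and the residual window (B5b)
  obtain ⟨c, M₁, hc, hM₁, hdens⟩ := h2 C₀ hC₀ |α| (abs_nonneg α)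
  obtain ⟨m, hm⟩ := hdens α u p U le_rfl hns hI hU hA
  obtain ⟨hlaw, hid⟩ := h3 h1 C₀ α u p U m c M₁ hns hI hU hA hm
  obtain ⟨ε₀, hε₀, hgap⟩ := h4 C₀ hC₀ c M₁ hc hM₁
  by_cases hsmall : 4 * α ^ 2 ≤ ε₀
  · exact hgap α u p U m hns hI hU hA hm (hlaw.trans hsmall)
  · have hlt : ε₀ < 4 * α ^ 2 := lt_of_not_ge hsmall
    have ha₀ : 0 < Real.sqrt ε₀ / 2 := by positivity
    have hle : Real.sqrt ε₀ / 2 ≤ |α| := by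
      have e₁ : Real.sqrt ε₀ ≤ Real.sqrt (4 * α ^ 2) := Real.sqrt_le_sqrt hlt.le
      have e₂ : Real.sqrt (4 * α ^ 2) = 2 * |α| := by
        rw [show (4 : ℝ) * α ^ 2 = (2 * |α|) ^ 2 by rw [mul_pow, sq_abs]; norm_num]
        exact Real.sqrt_sq (by positivity)
      linarith
    exact h5 C₀ hC₀ (Real.sqrt ε₀ / 2) α₂ ha₀ (hle.trans hαle) α hle hαle u p U m c M₁ hns hI hU hA
      hc hM₁ hm hlaw hid

/-- **Rate-class Liouville from its parts (proved composition).** Given the selection plug A2' and soliton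
Liouville for all α (from B1–B5b and the tree), every element of the Oseen-gauge Type-I rate class
`IsTypeIAncientMild C`, `C > 0`, vanishes on `t < 0`: otherwise A2' produces a non-trivial Type-I rotated
self-similar profile, which the Liouville theorem kills. Pure logic. -/
theorem rateClassLiouville_of_parts
    (hA2 : ∀ (C : ℝ), 0 < C → ∀ (v : ℝ → EuclideanSpace ℝ (Fin 3) → EuclideanSpace ℝ (Fin 3)), Literature.Analysis.FluidPDE.IsTypeIAncientMild C v → ¬ (∀ t < 0, ∀ x, v t x = 0) → ∃ C₀ : ℝ, 0 < C₀ ∧ ∃ (α : ℝ) (u : ℝ → EuclideanSpace ℝ (Fin 3) → EuclideanSpace ℝ (Fin 3)) (p : ℝ → EuclideanSpace ℝ (Fin 3) → ℝ) (U : EuclideanSpace ℝ (Fin 3) → EuclideanSpace ℝ (Fin 3)), Literature.Analysis.FluidPDE.IsClassicalNSSolutionOn (Set.Ico (-1) 0) 1 0 u p ∧ (∀ t ∈ Set.Ico (-1 : ℝ) 0, ∀ x : EuclideanSpace ℝ (Fin 3), ‖u t x‖ ≤ C₀ / (‖x‖ + Real.sqrt (-t))) ∧ ContDiff ℝ 2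 U ∧ (∀ t ∈ Set.Ico (-1 : ℝ) 0, ∀ x : EuclideanSpace ℝ (Fin 3), u t x = Literature.Analysis.FluidPDE.pvAnsatz α (fun y _ => U y) t x) ∧ U ≠ 0)
    (hL : ∀ C₀ : ℝ, 0 < C₀ → ∀ (α : ℝ) (u : ℝ → EuclideanSpace ℝ (Fin 3) → EuclideanSpace ℝ (Fin 3)) (p : ℝ → EuclideanSpace ℝ (Fin 3) → ℝ) (U : EuclideanSpace ℝ (Fin 3) → EuclideanSpace ℝ (Fin 3)), Literature.Analysis.FluidPDE.IsClassicalNSSolutionOn (Set.Ico (-1) 0) 1 0 u p → (∀ t ∈ Set.Ico (-1 : ℝ) 0, ∀ x : EuclideanSpace ℝ (Fin 3), ‖u t x‖ ≤ C₀ / (‖x‖ + Real.sqrt (-t))) → ContDiff ℝ 2 U → (∀ t ∈ Set.Ico (-1 : ℝ) 0, ∀ x : EuclideanSpace ℝ (Fin 3), u t x = Literature.Analysis.FluidPDE.pvAnsatz α (fun y _ => U y) t x) → U = 0) :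
    ∀ C : ℝ, 0 < C → ∀ v : ℝ → EuclideanSpace ℝ (Fin 3) → EuclideanSpace ℝ (Fin 3),
      Literature.Analysis.FluidPDE.IsTypeIAncientMild C v → ∀ t < 0, ∀ x, v t x = 0 := by
  intro C hC v hv
  by_contra hnz
  obtain ⟨C₀, hC₀, α, u, p, U, hns, hI, hU, hA, hU0⟩ := hA2 C hC v hv hnz
  exact hU0 (hL C₀ hC₀ α u p U hns hI hU hA)

/-- **The skeleton concludes the crux BY NAME** (primary route `TypeICertificateLadder`, payload.route_id):
`NoTypeIBlowup` (item stmt-NavierStokesRegularity-1217) from the six registered stubs, through the LANDED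
reduction `Theorems.noTypeIBlowup_of_rateClassLiouville` (p94280; it contains the landed Type-I zoom
`Theorems.stub_typeIZoom`, p87903, which is where the finite-energy / Leray–Hopf clause is used — Disproof §2). -/
theorem NoTypeIBlowup_of :
    Summit.NavierStokesRegularity.NavierStokesRegularity.Theses.TypeICertificateLadder.NoTypeIBlowup :=
  Summit.NavierStokesRegularity.NavierStokesRegularity.Theorems.noTypeIBlowup_of_rateClassLiouville
    (rateClassLiouville_of_parts stub_solitonSelection
      (rssLiouville_of_parts stub_twistedHeadIdentity stub_rotatingConjugateDensity stub_solitonLaws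
        stub_weightedGapLemma stub_windowLiouville))

/-- The same proof re-typed as `ThreadingFlux.Target` (the crux's name in route `ThreadingFlux`; syntactically
the same term as `TypeICertificateLadder.NoTypeIBlowup` and `CoreLogGas.NoTypeIBlowup`, Disproof.lean §0). -/
theorem Target_of : Summit.NavierStokesRegularity.NavierStokesRegularity.Theses.ThreadingFlux.Target :=
  NoTypeIBlowup_of

/-! ## Part E — where the two open stubs sit in the summit's item DAG (continuation lead c3, 2026-08-16)

Kernel-checked in `Theorems/TypeICertificateLadderTargetSolitonBridge*.lean` (all landed `--supports` stmt-1217):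
* B5b (`stub_windowLiouville`) ⇐ soliton Liouville in Pineau–Vicol's class (all `α`) ⇐
  `ExtremalTypeIConstant.SpiralScalingLiouville` (stmt-8216) and ⇐ `SymmetryModuliCount.SymmetricLiouville`
  (stmt-4053) (`solitonBridge_rssLiouville_of_spiralScalingLiouville`, `…_of_symmetricLiouville`, through the
  embedding `solitonBridge_isTypeIAncientMild` and the generator `solitonBridge_generator`); and CONVERSELY soliton
  Liouville ⇒ 4053 (`TypeICertificateLadderTargetSolitonBridgeEquivalence.lean`, proposal p119137: normal form
  `solitonBridge_axisNormalForm` + orbit integration `solitonBridge_pvAnsatz_of_generator` + KNSS pressure + that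
  route's Oseen bootstrap), so that **B5b verbatim ⇔ `SymmetricLiouville` (stmt-4053)**;
* A2' (`stub_solitonSelection`) ⇐ rate-class Liouville (vacuously) ⇐ `ForcedSymmetry` (stmt-4052)
  (`solitonBridge_solitonSelection_of_forcedSymmetry`), and A2' ⇔ rate-class Liouville MODULO soliton Liouville
  (`solitonBridge_solitonSelection_iff_rateClassLiouville`: given the B-side the external leaf is the crux core,
  as `headInfluxLaw_iff_rateClassLiouville` was for the dead line `head-flux-channel`);
* a NEW STRATUM for B5b (`solitonBridge_trivial_of_subcritical_tail`, unconditional): a Type-I RSS soliton of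
  P–V's class whose profile has subcritical tail `‖y‖‖U(y)‖ → 0` is trivial — a window counterexample has a
  non-vanishing blow-up trace (ESS backward uniqueness at the blow-up time).
Net: the residual of the crux on this line is EXACTLY route `SymmetryModuliCount`'s pair (4052, 4053), with
4050 ⇔ 4052 ∧ 4053 there and the crux ⇐ 4052 alone (`Theorems.noTypeIBlowup_of_forcedSymmetry`, p106694). -/

/-- **The crux from A2' and the sibling crux `SymmetricLiouville` (stmt-4053)** — the line's composition with
its open window stub B5b replaced by the sibling item it is equivalent to: soliton Liouville for all `α` comes
from 4053 (`Theorems.solitonBridge_rssLiouville_of_symmetricLiouville`), the rate class is then trivial by A2'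
(`rateClassLiouville_of_parts`), and `Theorems.noTypeIBlowup_of_rateClassLiouville` (p94280) concludes BY NAME.
Uses the registered stub `stub_solitonSelection` (sorry) and the open item 4053 as a hypothesis. -/
theorem NoTypeIBlowup_of_symmetricLiouville'
    (h4053 : Summit.NavierStokesRegularity.NavierStokesRegularity.Theses.SymmetryModuliCount.SymmetricLiouville) :
    Summit.NavierStokesRegularity.NavierStokesRegularity.Theses.TypeICertificateLadder.NoTypeIBlowup :=
  Summit.NavierStokesRegularity.NavierStokesRegularity.Theorems.noTypeIBlowup_of_rateClassLiouville
    (rateClassLiouville_of_parts stub_solitonSelection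
      (Summit.NavierStokesRegularity.NavierStokesRegularity.Theorems.solitonBridge_rssLiouville_of_symmetricLiouville
        h4053))

/-- **The crux from A2' and `SpiralScalingLiouville` (stmt-8216, route `ExtremalTypeIConstant`)** — the same
composition through the landed `Theorems.solitonBridge_noTypeIBlowup_of_solitonSelection_of_spiralScalingLiouville`,
fed with the registered stub `stub_solitonSelection` (sorry). -/
theorem NoTypeIBlowup_of_spiralScalingLiouville'
    (h8216 : Summit.NavierStokesRegularity.NavierStokesRegularity.Theses.ExtremalTypeIConstant.SpiralScalingLiouville) :
    Summit.NavierStokesRegularity.NavierStokesRegularity.Theses.TypeICertificateLadder.NoTypeIBlowup :=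
  Summit.NavierStokesRegularity.NavierStokesRegularity.Theorems.solitonBridge_noTypeIBlowup_of_solitonSelection_of_spiralScalingLiouville
    stub_solitonSelection h8216

/-- **B5b from stmt-8216** inside the skeleton: the registered window stub is discharged by the sibling item
(`Theorems.solitonBridge_windowLiouville_of_spiralScalingLiouville`); so a landing of 8216 (or of 4053, via the
Equivalence file) closes `stub_windowLiouville` in one line. -/
theorem stub_windowLiouville_of_spiralScalingLiouville
    (h8216 : Summit.NavierStokesRegularity.NavierStokesRegularity.Theses.ExtremalTypeIConstant.SpiralScalingLiouville) :
    ∀ C₀ : ℝ, 0 < C₀ → ∀ a₀ A₀ : ℝ, 0 < a₀ → a₀ ≤ A₀ → ∀ α : ℝ, a₀ ≤ |α| → |α| ≤ A₀ → ∀ (u : ℝ → EuclideanSpace ℝ (Fin 3) → EuclideanSpace ℝ (Fin 3)) (p : ℝ → EuclideanSpace ℝ (Fin 3) → ℝ) (U : EuclideanSpace ℝ (Fin 3) → EuclideanSpace ℝ (Fin 3)) (m : EuclideanSpace ℝ (Fin 3) → ℝ) (c M₁ : ℝ), Literature.Analysis.FluidPDE.IsClassicalNSSolutionOn (Set.Ico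 (-1) 0) 1 0 u p → (∀ t ∈ Set.Ico (-1 : ℝ) 0, ∀ x : EuclideanSpace ℝ (Fin 3), ‖u t x‖ ≤ C₀ / (‖x‖ + Real.sqrt (-t))) → ContDiff ℝ 2 U → (∀ t ∈ Set.Ico (-1 : ℝ) 0, ∀ x : EuclideanSpace ℝ (Fin 3), u t x = Literature.Analysis.FluidPDE.pvAnsatz α (fun y _ => U y) t x) → 0 < c → 0 < M₁ → (ContDiff ℝ 2 m ∧ (∀ y, 0 < m y) ∧ (∫ y, m y = 1) ∧ (∀ y, c * Real.exp (-(7 / 16 : ℝ) * ‖y‖ ^ 2) ≤ m y) ∧ (∀ y, m y ≤ M₁ * Real.exp (-(1 / 16 : ℝ) * ‖y‖ ^ 2)) ∧ (∃ M₂ : ℝ, ∀ y, ‖fderiv ℝ m y‖ ≤ M₂ * Real.exp (-(1 / 32 : ℝ) * ‖y‖ ^ 2)) ∧ (∀ y, Laplacian.laplacian m y + Literature.Analysis.FluidPDE.VectorCalculus.divergence (fun z => m z • (U z + (1 / 2 : ℝ) • z - α • Literature.Analysis.FluidPDE.rotGen z)) y = 0)) → (∫ y, ‖Literature.Analysis.FluidPDE.curl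 U y‖ ^ 2 * m y ≤ 4 * α ^ 2) → (∫ y, ‖Literature.Analysis.FluidPDE.curl U y‖ ^ 2 * m y = 2 * α * ∫ y, (Literature.Analysis.FluidPDE.curl U y) 2 * m y) → U = 0 :=
  Summit.NavierStokesRegularity.NavierStokesRegularity.Theorems.solitonBridge_windowLiouville_of_spiralScalingLiouville
    h8216

end Summit.NavierStokesRegularity.NavierStokesRegularity.Cruxes.Target.KillingTwistedBernoulliSolitons

end
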